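import Literature.Computability.QuantumComplexity.OracleClassicalProgs
import Literature.Computability.QuantumComplexity.OracleSimReplay
import Literature.Computability.QuantumComplexity.CoinFamilyKernel
import Literature.Computability.QuantumComplexity.RevMultiplex
import HarnessLib

/-!
# The oracle-simulation family, I: layout, program, circuit

Topic `Literature/Computability/QuantumComplexity`; fourth file of the discharge of the named fact
`uniformOracleCoinSimulation` (`CoinFamilyKernel.lean`): the classical part `D n`, *with oracle
gates*, of a coin family (`BQPProofs.coinFamily`: Hadamard coins, then `D n`) simulating a
polynomial-time oracle algorithm `M` (transcript model, budget `r`) run on `⟨x, coins⟩` relative to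
an oracle language `A` (Bernstein–Vazirani 1997, proof of Thm. 8.3 carried out with the oracle
queries of their §8.3: on a basis state a query gate writes the answer bit "just as in a classical
oracle machine").

**Layout** on input length `n` (`q = q(n)` coins, `x' = ⟨x, y⟩` of length `2n + 2 + q`,
`R = Q = r(|x'|)` rounds and maximal query length, `nS = R (R+1)` answer slots):
input `[0, n)`, coins `[n, n+q)`, answer slots `ansW t ℓ = n + q + t(R+1) + ℓ`, and one *stage*
`[Z₀, Z₀ + Wb)`, `Z₀ = n + q + nS`, holding the garbage-free block (`RevUncompute.lean`) of a
machine `Mr` computing a *block function* `F` which on block inputs `u = ⟨x', slots⟩` (of length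
`n₀ = 4n + 6 + 2q + nS`) is the word `OSim.wordσ` of `OracleSimReplay.lean` (the replay function
`replayFn M r` of `OracleSimReplayFP.lean` is such an `F`, supplied at assembly time).

**Program** (`ℕ`-wired `RtOp`s, `RazTalBlocks.lean`; classical semantics `OracleClassicalProgs.lean`):
round `t < R` is `fmt ++ B ++ orc t ++ B ++ fmt ++ fix t` — `fmt` writes `u` into the stage's data
wires by `CNOT`s from input, coins and slots and `NOT`s for the separators of the pairing; `B` is
the block at offset `Z₀`; `orc t` has one oracle gate per length `ℓ ≤ Q`, querying the first `ℓ`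
bits of query field `t` of the block's output word (read on the `true`-code wires of its output
cells) into slot `(t, ℓ)`; the second `B` erases the block's result (`RevClean.clEval_cleanOps_cleanOps`),
the second `fmt` together with `fix t` (which XORs the freshly written slots `(t, ·)` once more)
clears the stage's data wires. After the rounds: `fmt ++ B` and the swap of the output cells of the
word to the front wires. This file fixes the sizes and wires, defines the program `allOps`, proves
well-formedness and the wire bounds, and compiles the circuit `Dcirc P n` and the family
`OSim.family P`; semantics and uniformity follow in the sequels.

## References

* E. Bernstein, U. Vazirani, *Quantum complexity theory*, SIAM J. Comput. 26 (1997), Thm. 8.3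
  (p. 1451) and §8.3 (p. 1455) [BernsteinVazirani1997SICOMP].
* C. H. Bennett, E. Bernstein, G. Brassard, U. Vazirani, *Strengths and weaknesses of quantum
  computing*, SIAM J. Comput. 26 (1997), §2 (arXiv:quant-ph/9701001, p. 4) [BennettBernsteinBrassardVazirani1997].
* M. A. Nielsen, I. L. Chuang, *Quantum Computation and Quantum Information*, CUP 2010, §3.2.5,
  §6.1.1 [NielsenChuang2010].
-/

noncomputable section

namespace Literature.Computability.QuantumComplexity

namespace OSim

open _root_.Computability Complexity Cryptography RazTalMachine RevSim RevClean RevMux Turing Matrix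

/-! ### Parameters -/

/-- **The data of the simulation**: the oracle language, the oracle algorithm (string outputs),
the coin polynomial, the round/query budget, a block function `F` together with a machine computing
it within a power time bound (`RevClean.exists_outputsWithin_pow_of_mem_FP`), and the specification
of `F` on block inputs: the word of the replay against the slots read off the slot string
(`OracleSimReplayFP.replayFn_apply` provides it for `F = replayFn M r`).
[cite: BernsteinVazirani1997SICOMP, Thm. 8.3 (proof)] -/
structure Params where
  /-- the oracle language -/
  A : Language Bool
  /-- the oracle algorithm -/
  M : OracleAlg (List Bool)
  /-- the number of coins -/
  q : Polynomial ℕ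
  /-- the round and query-length budget -/
  r : Polynomial ℕ
  /-- the block function -/
  F : List Bool → List Bool
  /-- the time exponent of the block machine -/
  e : ℕ
  /-- the block machine -/
  Mr : TM2ComputableAux Bool Bool
  /-- the block machine computes the block function -/
  hMr : ∀ u : List Bool, Mr.OutputsWithin u (F u) (Tn e u.length)
  /-- on block inputs the block function is the word of the replay against the slots -/
  hF : ∀ x' ans : List Bool, r.eval x'.length ≤ (boolPair x' ans).length →
    F (boolPair x' ans) = wordσ M x' (fun s ℓ => ans.getD (s * (r.eval x'.length + 1) + ℓ) false)
      (r.eval x'.length) (r.eval x'.length)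

variable (P : Params)

/-! ### Sizes -/

/-- The number of coins `q(n)`. [folklore] -/
abbrev qn (n : ℕ) : ℕ := P.q.eval n

/-- The length of the algorithm's input `x' = ⟨x, y⟩`. [folklore] -/
def nx (n : ℕ) : ℕ := 2 * n + 2 + qn P n

/-- The number of rounds, also the maximal query length `Q`. [folklore] -/
def R (n : ℕ) : ℕ := P.r.eval (nx P n)

/-- The number of answer slots `R (R + 1)`. [folklore] -/
def nS (n : ℕ) : ℕ := R P n * (R P n + 1)

/-- The length of the block input `u = ⟨x', slots⟩`. [folklore] -/
def n0 (n : ℕ) : ℕ := 4 * n + 6 + 2 * qn P n + nS P n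

/-- The first wire of the stage. [folklore] -/
def Z0 (n : ℕ) : ℕ := n + qn P n + nS P n

/-- The width of the stage (the block's width). [folklore] -/
def Wb (n : ℕ) : ℕ := width P.e P.Mr (n0 P n)

/-- The work wires beyond input and coins: slots and stage. [folklore] -/
def mAnc (n : ℕ) : ℕ := nS P n + Wb P n

/-- The total number of wires, in the shape `n + (q n + m n)` of a coin family. [folklore] -/
def W (n : ℕ) : ℕ := n + (qn P n + mAnc P n)

/-- The total width is the stage offset plus the stage width. [folklore] -/
theorem W_eq (n : ℕ) : W P n = Z0 P n + Wb P n := by unfold W Z0 mAnc; omega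

/-- The length of `x'`. [folklore] -/
theorem length_xPair {n : ℕ} (xs ys : List Bool) (hx : xs.length = n) (hy : ys.length = qn P n) :
    (boolPair xs ys).length = nx P n := by rw [length_boolPair, hx, hy, nx]

/-- The length of the block input. [folklore] -/
theorem length_blockInput {n : ℕ} (xs ys as : List Bool) (hx : xs.length = n) (hy : ys.length = qn P n)
    (ha : as.length = nS P n) : (boolPair (boolPair xs ys) as).length = n0 P n := by
  rw [length_boolPair, length_boolPair, hx, hy, ha, n0]; ring

/-! ### Wires -/

/-- The wire of answer slot `(t, ℓ)`. [folklore] -/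
def ansW (n t ℓ : ℕ) : ℕ := n + qn P n + (t * (R P n + 1) + ℓ)

/-- The position of slot `k = t (R+1) + ℓ` inside the block input. [folklore] -/
def posA (n k : ℕ) : ℕ := 4 * n + 6 + 2 * qn P n + k

/-- The `true`-code wire of output cell `j` of the block (global numbering). [folklore] -/
def tW (n j : ℕ) : ℕ := Z0 P n + resW P.e P.Mr (n0 P n) j (CWrap.symTrue P.Mr)

/-- The number of output cells moved to the front. [folklore] -/
def Bout (n : ℕ) : ℕ := JJ P.e P.Mr (n0 P n) - R P n * R P n

/-! ### Elementary inequalities -/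

/-- The block input fits below the represented cells: `n₀ ≤ JJ`. [folklore] -/
theorem n0_le_JJ (n : ℕ) : n0 P n ≤ JJ P.e P.Mr (n0 P n) := by unfold JJ Sn; omega

/-- `nS < n₀`. [folklore] -/
theorem nS_lt_n0 (n : ℕ) : nS P n < n0 P n := by unfold n0; omega

/-- `R² ≤ nS`. [folklore] -/
theorem sq_le_nS (n : ℕ) : R P n * R P n ≤ nS P n := by unfold nS; nlinarith

/-- Query cells lie inside the represented cells. [folklore] -/
theorem cell_lt_JJ {n t i : ℕ} (ht : t < R P n) (hi : i < R P n) : t * R P n + i < JJ P.e P.Mr (n0 P n) := by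
  have h1 : t * R P n + i < R P n * R P n := by nlinarith
  exact lt_of_lt_of_le h1 ((sq_le_nS P n).trans ((nS_lt_n0 P n).le.trans (n0_le_JJ P n)))

/-- Output cells lie inside the represented cells. [folklore] -/
theorem outCell_lt_JJ {n j : ℕ} (hj : j < Bout P n) : R P n * R P n + j < JJ P.e P.Mr (n0 P n) := by
  unfold Bout at hj; omega

/-- A slot index of a round `t < R`, `ℓ ≤ R`, is below `nS`. [folklore] -/
theorem slot_lt_nS {n t ℓ : ℕ} (ht : t < R P n) (hℓ : ℓ ≤ R P n) : t * (R P n + 1) + ℓ < nS P n := by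
  unfold nS
  have : (t + 1) * (R P n + 1) ≤ R P n * (R P n + 1) := Nat.mul_le_mul_right _ ht
  nlinarith

/-- Slot wires are below the stage. [folklore] -/
theorem ansW_lt_Z0 {n t ℓ : ℕ} (ht : t < R P n) (hℓ : ℓ ≤ R P n) : ansW P n t ℓ < Z0 P n := by
  unfold ansW Z0; have := slot_lt_nS P ht hℓ; omega

/-- Positions of slots inside the block input. [folklore] -/
theorem posA_lt_n0 {n k : ℕ} (hk : k < nS P n) : posA P n k < n0 P n := by unfold posA n0; omega

/-- The block input fits in the stage. [folklore] -/
theorem n0_le_Wb (n : ℕ) : n0 P n ≤ Wb P n := (le_NN (e := P.e) (M := P.Mr) _).trans (NN_le_width _)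

/-- `true`-code wires of represented cells are inside the stage. [folklore] -/
theorem tW_lt_W {n j : ℕ} (hj : j < JJ P.e P.Mr (n0 P n)) : tW P n j < W P n := by
  rw [W_eq, tW]; exact Nat.add_lt_add_left (resW_lt_width hj _) _

/-- `true`-code wires lie beyond `Z₀ + NN ≥ JJ`. [folklore] -/
theorem JJ_le_tW (n j : ℕ) : JJ P.e P.Mr (n0 P n) ≤ tW P n j :=
  (CWrap.JJ_le_NN _).trans ((NN_le_resW _ _ _).trans (Nat.le_add_left _ _))

/-- `Z₀ ≤ tW`. [folklore] -/
theorem Z0_le_tW (n j : ℕ) : Z0 P n ≤ tW P n j := Nat.le_add_right _ _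

/-- `tW` is injective in the cell. [folklore] -/
theorem tW_injective (n : ℕ) : Function.Injective (tW P n) := fun _ _ h =>
  (resW_inj (Nat.add_left_cancel h)).1

/-- The stage ends at `W`. [folklore] -/
theorem Z0_add_lt_W {n i : ℕ} (hi : i < Wb P n) : Z0 P n + i < W P n := by rw [W_eq]; omega

/-- The total width is positive. [folklore] -/
theorem W_pos (n : ℕ) : 0 < W P n := by
  have := n0_le_Wb P n; rw [W_eq]; unfold n0 at this; omega

/-- The front window of the output fits: `Bout ≤ JJ ≤ W`. [folklore] -/
theorem Bout_le_JJ (n : ℕ) : Bout P n ≤ JJ P.e P.Mr (n0 P n) := Nat.sub_le _ _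

/-- `JJ ≤ W`. [folklore] -/
theorem JJ_le_W (n : ℕ) : JJ P.e P.Mr (n0 P n) ≤ W P n := by
  rw [W_eq]; exact ((CWrap.JJ_le_NN _).trans (NN_le_width _)).trans (Nat.le_add_left _ _)

/-! ### The program -/

/-- **The format gadget**: writes `u = ⟨⟨x, y⟩, slots⟩` into the data wires of the stage — every
input bit four times, the doubled separator `0011`, every coin twice, the separator `01`, the
slots once (the `0`s of the separators need no gate). [cite: AroraBarak2009, §0.1 (pairing)] -/
def fmtOps (n : ℕ) : List (ClOp ℕ) :=
  ((List.range n).flatMap fun i => (List.range 4).map fun c => ClOp.cnot i (Z0 P n + (4 * i + c))) ++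
    ([ClOp.not (Z0 P n + (4 * n + 2)), ClOp.not (Z0 P n + (4 * n + 3))] ++
      (((List.range (qn P n)).flatMap fun j => (List.range 2).map fun c =>
          ClOp.cnot (n + j) (Z0 P n + (4 * n + 4 + (2 * j + c)))) ++
        ([ClOp.not (Z0 P n + (4 * n + 4 + 2 * qn P n + 1))] ++
          ((List.range (nS P n)).map fun k => ClOp.cnot (n + qn P n + k) (Z0 P n + posA P n k)))))

/-- **The block**: the garbage-free block of the replay machine, placed at the stage. [cite: Shor1997, §3 p.8] -/
def blkOps (n : ℕ) : List (ClOp ℕ) := (cleanOps P.e P.Mr (n0 P n) []).map (ClOp.map (· + Z0 P n))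

/-- **The oracle gates of round `t`**: for every length `ℓ ≤ Q`, query the first `ℓ` bits of query
field `t` of the word (cells `tQ, …, tQ + ℓ - 1`) into slot `(t, ℓ)`. [cite: BernsteinVazirani1997SICOMP, §8.3] -/
def orcOps (n t : ℕ) : List (RtOp ℕ) :=
  (List.range (R P n + 1)).map fun ℓ => RtOp.oracle ((List.range ℓ).map fun i => tW P n (t * R P n + i)) (ansW P n t ℓ)

/-- **The fix-up of round `t`**: XOR the slots `(t, ℓ)` once more into their positions in the
stage's data wires (clearing what the second format gadget left there). [folklore] -/
def fixOps (n t : ℕ) : List (ClOp ℕ) :=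
  (List.range (R P n + 1)).map fun ℓ => ClOp.cnot (ansW P n t ℓ) (Z0 P n + posA P n (t * (R P n + 1) + ℓ))

/-- **Round `t`**: `fmt B orc B fmt fix`. [cite: BernsteinVazirani1997SICOMP, Thm. 8.3 (proof) with §8.3] -/
def roundOps (n t : ℕ) : List (RtOp ℕ) :=
  (fmtOps P n ++ blkOps P n).map RtOp.cl ++ (orcOps P n t ++ (blkOps P n ++ (fmtOps P n ++ fixOps P n t)).map RtOp.cl)

/-- The output swap pairs: cell `R·Q + j` of the word to front wire `j`. [folklore] -/
def outPairs (n : ℕ) : List (ℕ × ℕ) := (List.range (Bout P n)).map fun j => (tW P n (R P n * R P n + j), j)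

/-- The output swaps. [cite: NielsenChuang2010, §1.3.4 (swap from three CNOTs)] -/
def swpOps (n : ℕ) : List (ClOp ℕ) := swapOps (outPairs P n)

/-- The final stage: format, block, output swaps. [folklore] -/
def finOps (n : ℕ) : List (ClOp ℕ) := fmtOps P n ++ (blkOps P n ++ swpOps P n)

/-- **The whole program** of the classical part `D n`. [cite: BernsteinVazirani1997SICOMP, Thm. 8.3 (proof) with §8.3] -/
def allOps (n : ℕ) : List (RtOp ℕ) := (List.range (R P n)).flatMap (roundOps P n) ++ (finOps P n).map RtOp.cl

/-! ### Well-formedness and wire bounds -/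

section Bounds

variable {P} {n t : ℕ}

/-- Members of the format gadget. [folklore] -/
theorem mem_fmtOps {op : ClOp ℕ} (hop : op ∈ fmtOps P n) :
    (∃ s i, s < Z0 P n ∧ i < n0 P n ∧ op = ClOp.cnot s (Z0 P n + i)) ∨ (∃ i, i < n0 P n ∧ op = ClOp.not (Z0 P n + i)) := by
  simp only [fmtOps, List.mem_append, List.mem_flatMap, List.mem_map, List.mem_range, List.mem_cons,
    List.not_mem_nil, or_false] at hop
  rcases hop with ⟨i, hi, c, hc, rfl⟩ | (rfl | rfl) | ⟨j, hj, c, hc, rfl⟩ | rfl | ⟨k, hk, rfl⟩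
  · exact Or.inl ⟨i, 4 * i + c, by unfold Z0; omega, by unfold n0; omega, rfl⟩
  · exact Or.inr ⟨_, by unfold n0; omega, rfl⟩
  · exact Or.inr ⟨_, by unfold n0; omega, rfl⟩
  · exact Or.inl ⟨n + j, _, by unfold Z0; omega, by unfold n0; omega, rfl⟩
  · exact Or.inr ⟨_, by unfold n0; omega, rfl⟩
  · exact Or.inl ⟨n + qn P n + k, posA P n k, by unfold Z0; omega, posA_lt_n0 P hk, rfl⟩

/-- The format gadget is well formed. [folklore] -/
theorem fmtOps_wf : ∀ op ∈ fmtOps P n, op.WF := fun op hop => by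
  rcases mem_fmtOps hop with ⟨s, i, hs, -, rfl⟩ | ⟨i, -, rfl⟩
  · exact fun h => by omega
  · trivial

/-- The wires of the format gadget. [folklore] -/
theorem fmtOps_lt : ∀ op ∈ fmtOps P n, ∀ w ∈ wiresOf op, w < W P n := fun op hop w hw => by
  have hn0 := n0_le_Wb P n
  rcases mem_fmtOps hop with ⟨s, i, hs, hi, rfl⟩ | ⟨i, hi, rfl⟩
  · simp only [mem_wiresOf, ClOp.target, ClOp.controls, List.mem_singleton] at hw
    rcases hw with rfl | rfl
    · exact Z0_add_lt_W P (lt_of_lt_of_le hi hn0)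
    · rw [W_eq]; omega
  · simp only [mem_wiresOf, ClOp.target, ClOp.controls, List.not_mem_nil, or_false] at hw
    subst hw; exact Z0_add_lt_W P (lt_of_lt_of_le hi hn0)

/-- The block is well formed. [folklore] -/
theorem blkOps_wf : ∀ op ∈ blkOps P n, op.WF := fun op hop => by
  obtain ⟨op', hop', rfl⟩ := List.mem_map.1 hop
  exact (cleanOps_wf op' hop').map fun a b h => Nat.add_right_cancel h

/-- The wires of the block. [folklore] -/
theorem blkOps_lt : ∀ op ∈ blkOps P n, ∀ w ∈ wiresOf op, w < W P n := fun op hop w hw => by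
  obtain ⟨op', hop', rfl⟩ := List.mem_map.1 hop
  have hw' : w ∈ (wiresOf op').map (· + Z0 P n) := by
    cases op' <;> simpa [wiresOf, ClOp.map, ClOp.target, ClOp.controls] using hw
  obtain ⟨i, hi, rfl⟩ := List.mem_map.1 hw'
  have := cleanOps_nil_lt op' hop' i hi
  rw [W_eq, Nat.add_comm]; unfold Wb; omega

/-- The wires of the block lie in the stage. [folklore] -/
theorem blkOps_ge : ∀ op ∈ blkOps P n, ∀ w ∈ wiresOf op, Z0 P n ≤ w := fun op hop w hw => by
  obtain ⟨op', hop', rfl⟩ := List.mem_map.1 hop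
  have hw' : w ∈ (wiresOf op').map (· + Z0 P n) := by
    cases op' <;> simpa [wiresOf, ClOp.map, ClOp.target, ClOp.controls] using hw
  obtain ⟨i, -, rfl⟩ := List.mem_map.1 hw'
  exact Nat.le_add_left _ _

/-- The oracle gates are well formed (for `t < R`). [folklore] -/
theorem orcOps_wf (ht : t < R P n) : ∀ op ∈ orcOps P n t, op.WF := fun op hop => by
  obtain ⟨ℓ, hℓ, rfl⟩ := List.mem_map.1 hop
  have hℓ' : ℓ ≤ R P n := Nat.lt_succ_iff.1 (List.mem_range.1 hℓ)
  change (_ ++ [_]).Nodup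
  rw [List.nodup_append]
  refine ⟨(List.nodup_range.map_on fun i hi j hj h => ?_), List.nodup_singleton _, ?_⟩
  · have := tW_injective P n h; omega
  · intro a ha b hb hab
    subst hab
    obtain ⟨i, -, rfl⟩ := List.mem_map.1 ha
    rw [List.mem_singleton] at hb
    exact absurd (hb ▸ Z0_le_tW P n _) (Nat.not_le.2 (ansW_lt_Z0 P ht hℓ'))

/-- The wires of the oracle gates (for `t < R`). [folklore] -/
theorem orcOps_lt (ht : t < R P n) : ∀ op ∈ orcOps P n t, ∀ w ∈ op.wires, w < W P n := fun op hop w hw => by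
  obtain ⟨ℓ, hℓ, rfl⟩ := List.mem_map.1 hop
  have hℓ' : ℓ ≤ R P n := Nat.lt_succ_iff.1 (List.mem_range.1 hℓ)
  simp only [RtOp.wires, List.mem_append, List.mem_map, List.mem_range, List.mem_singleton] at hw
  rcases hw with ⟨i, hi, rfl⟩ | rfl
  · exact tW_lt_W P (cell_lt_JJ P ht (by omega))
  · exact lt_of_lt_of_le (ansW_lt_Z0 P ht hℓ') (by rw [W_eq]; omega)

/-- The fix-up is well formed (for `t < R`). [folklore] -/
theorem fixOps_wf (ht : t < R P n) : ∀ op ∈ fixOps P n t, op.WF := fun op hop => by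
  obtain ⟨ℓ, hℓ, rfl⟩ := List.mem_map.1 hop
  have := ansW_lt_Z0 P ht (Nat.lt_succ_iff.1 (List.mem_range.1 hℓ))
  exact fun h => by omega

/-- The wires of the fix-up (for `t < R`). [folklore] -/
theorem fixOps_lt (ht : t < R P n) : ∀ op ∈ fixOps P n t, ∀ w ∈ wiresOf op, w < W P n := fun op hop w hw => by
  obtain ⟨ℓ, hℓ, rfl⟩ := List.mem_map.1 hop
  have hℓ' : ℓ ≤ R P n := Nat.lt_succ_iff.1 (List.mem_range.1 hℓ)
  simp only [mem_wiresOf, ClOp.target, ClOp.controls, List.mem_singleton] at hw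
  rcases hw with rfl | rfl
  · exact Z0_add_lt_W P (lt_of_lt_of_le (posA_lt_n0 P (slot_lt_nS P ht hℓ')) (n0_le_Wb P n))
  · exact lt_of_lt_of_le (ansW_lt_Z0 P ht hℓ') (by rw [W_eq]; omega)

/-- The output pairs join a stage wire beyond `JJ` to a front wire below `JJ`. [folklore] -/
theorem mem_outPairs {p : ℕ × ℕ} (hp : p ∈ outPairs P n) :
    ∃ j, j < Bout P n ∧ p = (tW P n (R P n * R P n + j), j) := by
  obtain ⟨j, hj, rfl⟩ := List.mem_map.1 hp
  exact ⟨j, List.mem_range.1 hj, rfl⟩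

/-- The swaps are well formed. [folklore] -/
theorem swpOps_wf : ∀ op ∈ swpOps P n, op.WF :=
  swapOps_wf fun p hp => by
    obtain ⟨j, hj, rfl⟩ := mem_outPairs hp
    have h1 := JJ_le_tW P n (R P n * R P n + j)
    have h2 := (Bout_le_JJ P n)
    simp only; omega

/-- The wires of the swaps. [folklore] -/
theorem swpOps_lt : ∀ op ∈ swpOps P n, ∀ w ∈ wiresOf op, w < W P n := fun op hop w hw => by
  obtain ⟨p, hp, h⟩ := mem_swapOps hop
  obtain ⟨j, hj, rfl⟩ := mem_outPairs hp
  have h1 : tW P n (R P n * R P n + j) < W P n := tW_lt_W P (outCell_lt_JJ P hj)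
  have h2 : j < W P n := lt_of_lt_of_le hj ((Bout_le_JJ P n).trans (JJ_le_W P n))
  rcases h with rfl | rfl <;>
  · simp only [mem_wiresOf, ClOp.target, ClOp.controls, List.mem_singleton] at hw
    rcases hw with rfl | rfl <;> assumption

/-- A mapped classical list is well formed / bounded from the `ClOp` facts. [folklore] -/
theorem cl_wf {ops : List (ClOp ℕ)} (h : ∀ op ∈ ops, op.WF) : ∀ op ∈ ops.map RtOp.cl, RtOp.WF op := fun op hop => by
  obtain ⟨op', hop', rfl⟩ := List.mem_map.1 hop; exact h op' hop'

/-- Wires of a mapped classical list. [folklore] -/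
theorem cl_lt {ops : List (ClOp ℕ)} (h : ∀ op ∈ ops, ∀ w ∈ wiresOf op, w < W P n) :
    ∀ op ∈ ops.map RtOp.cl, ∀ w ∈ RtOp.wires op, w < W P n := fun op hop => by
  obtain ⟨op', hop', rfl⟩ := List.mem_map.1 hop; exact h op' hop'

/-- A mapped classical list is classical. [folklore] -/
theorem cl_isCl {ops : List (ClOp ℕ)} : ∀ op ∈ ops.map RtOp.cl, IsCl op := fun op hop => by
  obtain ⟨op', -, rfl⟩ := List.mem_map.1 hop; trivial

/-- Round `t < R` is well formed. [folklore] -/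
theorem roundOps_wf (ht : t < R P n) : ∀ op ∈ roundOps P n t, op.WF := by
  intro op hop
  simp only [roundOps, List.map_append, List.mem_append] at hop
  rcases hop with (h | h) | h | h | h | h
  · exact cl_wf fmtOps_wf op h
  · exact cl_wf blkOps_wf op h
  · exact orcOps_wf ht op h
  · exact cl_wf blkOps_wf op h
  · exact cl_wf fmtOps_wf op h
  · exact cl_wf (fixOps_wf ht) op h

/-- The wires of round `t < R`. [folklore] -/
theorem roundOps_lt (ht : t < R P n) : ∀ op ∈ roundOps P n t, ∀ w ∈ op.wires, w < W P n := by
  intro op hop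
  simp only [roundOps, List.map_append, List.mem_append] at hop
  rcases hop with (h | h) | h | h | h | h
  · exact cl_lt fmtOps_lt op h
  · exact cl_lt blkOps_lt op h
  · exact orcOps_lt ht op h
  · exact cl_lt blkOps_lt op h
  · exact cl_lt fmtOps_lt op h
  · exact cl_lt (fixOps_lt ht) op h

/-- Round `t` is classical-or-query. [folklore] -/
theorem roundOps_isCl (t : ℕ) : ∀ op ∈ roundOps P n t, IsCl op := by
  intro op hop
  simp only [roundOps, List.map_append, List.mem_append] at hop
  rcases hop with (h | h) | h | h | h | h
  · exact cl_isCl op h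
  · exact cl_isCl op h
  · obtain ⟨ℓ, -, rfl⟩ := List.mem_map.1 h; trivial
  · exact cl_isCl op h
  · exact cl_isCl op h
  · exact cl_isCl op h

/-- The final stage is well formed. [folklore] -/
theorem finOps_wf : ∀ op ∈ finOps P n, op.WF := fun op hop => by
  simp only [finOps, List.mem_append] at hop
  rcases hop with h | h | h
  · exact fmtOps_wf op h
  · exact blkOps_wf op h
  · exact swpOps_wf op h

/-- The wires of the final stage. [folklore] -/
theorem finOps_lt : ∀ op ∈ finOps P n, ∀ w ∈ wiresOf op, w < W P n := fun op hop => by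
  simp only [finOps, List.mem_append] at hop
  rcases hop with h | h | h
  · exact fmtOps_lt op h
  · exact blkOps_lt op h
  · exact swpOps_lt op h

variable (P n)

/-- **The program is well formed.** [folklore] -/
theorem allOps_wf : ∀ op ∈ allOps P n, op.WF := fun op hop => by
  simp only [allOps, List.mem_append, List.mem_flatMap, List.mem_range] at hop
  rcases hop with ⟨t, ht, h⟩ | h
  · exact roundOps_wf ht op h
  · exact cl_wf finOps_wf op h

/-- **The wires of the program are below `W`.** [folklore] -/
theorem allOps_lt : ∀ op ∈ allOps P n, ∀ w ∈ op.wires, w < W P n := fun op hop => by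
  simp only [allOps, List.mem_append, List.mem_flatMap, List.mem_range] at hop
  rcases hop with ⟨t, ht, h⟩ | h
  · exact roundOps_lt ht op h
  · exact cl_lt finOps_lt op h

/-- **The program is classical-or-query** (no Hadamards: those are the coin layer of the family).
[folklore] -/
theorem allOps_isCl : ∀ op ∈ allOps P n, IsCl op := fun op hop => by
  simp only [allOps, List.mem_append, List.mem_flatMap, List.mem_range] at hop
  rcases hop with ⟨t, -, h⟩ | h
  · exact roundOps_isCl t op h
  · exact cl_isCl op h

end Bounds

/-! ### The circuit and the family -/

/-- The re-indexing of wires to `Fin (W n)`. [folklore] -/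
def foW (n : ℕ) : ℕ → Fin (W P n) := finOf (W P n) (W_pos P n)

/-- The well-formedness of the re-indexed program. [folklore] -/
theorem allOps_map_wf (n : ℕ) : ∀ op ∈ (allOps P n).map (RtOp.map (foW P n)), op.WF :=
  wf_map_finOf_of (W_pos P n) (allOps_wf P n) (allOps_lt P n)

/-- **The classical part `D n`** of the simulating family: the compiled program on `W n` wires
(Clifford+T gates for the classical operations, oracle gates for the queries).
[cite: BernsteinVazirani1997SICOMP, Thm. 8.3 (proof) with §8.3] -/
def Dcirc (n : ℕ) : QCircuit cliffordT (W P n) :=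
  ⟨RtOp.compileList ((allOps P n).map (RtOp.map (foW P n))) (allOps_map_wf P n)⟩

/-- **The simulating family**: Hadamard coins on the `q(n)` coin wires, then `D n`.
[cite: BernsteinVazirani1997SICOMP, Thm. 8.3 (proof)] -/
def family : QCircuitFamily cliffordT := coinFamily (fun n => P.q.eval n) (mAnc P) (Dcirc P)

/-- **`D n` on a basis state is the classical run of the program**, relative to the oracle `A`.
[cite: BernsteinVazirani1997SICOMP, Thm. 8.3 (proof) with §8.3] -/
theorem Dcirc_mulVec_basisState (A : Language Bool) (n : ℕ) (w : QReg (W P n)) :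
    (Dcirc P n).toMatrix A *ᵥ basisState w = basisState fun p => ocEval A (allOps P n) (liftW w) p :=
  compileList_map_mulVec_basisState A (W_pos P n) (allOps P n) (allOps_isCl P n) (allOps_lt P n) _ w

end OSim

end Literature.Computability.QuantumComplexity

end
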